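import Mathlib.Combinatorics.SimpleGraph.Connectivity.Connected
import Literature.Probability.Percolation.SiteConnectionTools
import HarnessLib

/-!
# Exploration from outside: the random volume not reached through passable sites

Topic `Probability/LatticeModels` (pure combinatorics of a locally finite graph; no measure).
In the percolation analysis of Gibbs measures (Georgii–Higuchi 2000, proofs of Lemma 2.1,
Lemma 2.2 and Prop. 5.1) one conditions on "the largest random subset `Γ` of `Λ` which is the
interior of a `-∗`circuit" (resp. of a circuit on which a boundary inequality holds) and uses
that `Γ` is *determined from outside* and carries the wanted boundary spins. This file provides a
circuit-free substitute with the same two properties, valid on any locally finite graph: given a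
finite volume `Λ` and a set `T` of *passable* sites, a site `y ∈ Λ` is **exitable**
(`Exitable G Λ T y`) if there is a path `y ∼ t₁ ∼ ⋯ ∼ t_k ∼ z` with `z ∉ Λ` and passable interior
sites `tᵢ ∈ T ∩ Λ`; the **exploration volume** is `explVolume G Λ T = {y ∈ Λ | ¬ exitable}`.

* `Exitable.of_subset` — monotone in `T`.
* `setOf_exitable_eq_iff` / `explVolume_eq_iff` — *determined from outside*: whether
  `explVolume G Λ T = Γ` depends on `T` only through `T ∩ (Λ \ Γ)` (passable sites met along
  exit paths are themselves exitable).
* `not_mem_of_adj_explVolume` — *boundary property*: a site outside `explVolume` adjacent to it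
  lies in `Λ` and is not passable (so with `T = {+ spins}` the outer boundary of the exploration
  volume is `-`, as for the interior of an outermost `-∗`circuit).
* `Exitable.exists_reachable`, `exists_reachable_innerBoundary_of_not_mem_explVolume` — an
  exitable passable site is joined inside `T ∩ Λ` to a passable site of the inner boundary of `Λ`
  (so "`Δ ⊄ explVolume`" forces a
  long passable path, cf. Georgii–Higuchi's "with probability close to 1 such a circuit can
  already be found within a square `Λ`").

## References

* H.-O. Georgii, Y. Higuchi, J. Math. Phys. 41 (2000) 1153–1169, proof of Lemma 2.1 (pp. 4–5)
  and of Lemma 2.2 (p. 5) [GeorgiiHiguchi2000].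
-/

namespace Literature.Probability.LatticeModels

open SimpleGraph

variable {V : Type*} (G : SimpleGraph V)

/-! ### Exitable sites -/

/-- `Exitable G Λ T y`: the site `y ∈ Λ` can be joined to the outside of the finite volume `Λ`
by a path of `G` all of whose interior sites are passable (in `T`) and in `Λ`. Inductively: `y`
has a neighbour outside `Λ`, or a passable neighbour which is itself exitable (Georgii–Higuchi
2000, proof of Lemma 2.1: the sites of `Λ` outside the interior of the outermost `-∗`circuit
are those joined to `Λᶜ` by `+`paths). [cite: GeorgiiHiguchi2000, Lemma 2.1 (proof, pp. 4–5)] -/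
inductive Exitable (Λ : Finset V) (T : Set V) : V → Prop
  | base {y z : V} : y ∈ Λ → z ∉ Λ → G.Adj y z → Exitable Λ T y
  | step {y t : V} : y ∈ Λ → t ∈ T → G.Adj y t → Exitable Λ T t → Exitable Λ T y

variable {G}

namespace Exitable

variable {Λ : Finset V} {T T' : Set V} {y : V}

/-- An exitable site lies in the volume. [cite: GeorgiiHiguchi2000, Lemma 2.1 (proof, pp. 4–5)] -/
theorem mem (h : Exitable G Λ T y) : y ∈ Λ := by
  cases h with
  | base hy _ _ => exact hy
  | step hy _ _ _ => exact hy

/-- Exitability is monotone in the set of passable sites. [cite: GeorgiiHiguchi2000, Lemma 2.1 (proof, pp. 4–5)] -/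
theorem of_subset (hTT' : T ⊆ T') (h : Exitable G Λ T y) : Exitable G Λ T' y := by
  induction h with
  | base hy hz hadj => exact .base hy hz hadj
  | step hy ht hadj _ ih => exact .step hy (hTT' ht) hadj ih

/-- **Passable sites used along an exit path are themselves exitable**: exitability for `T` is
exitability for the smaller passable set `T ∩ {exitable sites}`. [cite: GeorgiiHiguchi2000, Lemma 2.1 (proof, pp. 4–5)] -/
theorem inter_setOf (h : Exitable G Λ T y) : Exitable G Λ (T ∩ {v | Exitable G Λ T v}) y := by
  induction h with
  | base hy hz hadj => exact .base hy hz hadj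
  | step hy ht hadj hex ih => exact .step hy ⟨ht, hex⟩ hadj ih

/-- If a passable site is exitable, it is joined through passable sites of `Λ` to a passable site
of `Λ` having a neighbour outside `Λ` (unwinding the inductive definition into a path in the
subgraph of `G` induced on `T ∩ Λ`, `Percolation.siteOpenGraph`). [cite: GeorgiiHiguchi2000, Lemma 2.1 (proof, pp. 4–5)] -/
theorem exists_reachable (h : Exitable G Λ T y) (hyT : y ∈ T) :
    ∃ t', t' ∈ Λ ∧ t' ∈ T ∧ (∃ z, z ∉ Λ ∧ G.Adj t' z) ∧
      (Percolation.siteOpenGraph G (T ∩ ↑Λ)).Reachable y t' := by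
  induction h with
  | @base y z hy hz hadj => exact ⟨y, hy, hyT, ⟨z, hz, hadj⟩, Reachable.refl _⟩
  | @step y t hy ht hadj hex ih =>
    obtain ⟨t', ht'Λ, ht'T, hz, hreach⟩ := ih ht
    refine ⟨t', ht'Λ, ht'T, hz, Reachable.trans (Adj.reachable ?_) hreach⟩
    rw [Percolation.siteOpenGraph_adj]
    exact ⟨hadj, ⟨hyT, Finset.mem_coe.2 hy⟩, ⟨ht, Finset.mem_coe.2 hex.mem⟩⟩

end Exitable

/-- **Determination from outside, pointwise form**: for any set `E`, if the exitable sites for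
`T` are exactly `E` then so are the exitable sites for `T ∩ E`, and conversely. [cite: GeorgiiHiguchi2000, Lemma 2.1 (proof, pp. 4–5)] -/
theorem setOf_exitable_eq_iff {Λ : Finset V} {T E : Set V} :
    {v | Exitable G Λ T v} = E ↔ {v | Exitable G Λ (T ∩ E) v} = E := by
  constructor
  · intro h
    apply Set.Subset.antisymm
    · intro v hv
      rw [← h]
      exact hv.of_subset Set.inter_subset_left
    · intro v hv
      have hv' : Exitable G Λ T v := by rw [← h] at hv; exact hv
      have := hv'.inter_setOf
      rwa [h] at this
  · intro h
    apply Set.Subset.antisymm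
    · -- every `T`-exit path only uses passable sites of `E`: induction along the path
      intro v hv
      induction hv with
      | base hy hz hadj =>
        rw [← h, Set.mem_setOf_eq]
        exact .base hy hz hadj
      | @step y t hy ht hadj _ ih =>
        have htE : t ∈ E := ih
        have ih' : Exitable G Λ (T ∩ E) t := by rw [← h] at ih; exact ih
        rw [← h, Set.mem_setOf_eq]
        exact .step hy ⟨ht, htE⟩ hadj ih'
    · intro v hv
      rw [← h] at hv
      exact hv.of_subset Set.inter_subset_left

/-! ### The exploration volume -/

/-- The **exploration volume** `{y ∈ Λ | y is not exitable through T}`: the sites of `Λ` shielded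
from `Λᶜ` by non-passable sites (for `T = {+ spins}`: the part of `Λ` enclosed by `-` spins,
replacing the interior of the outermost `-∗`circuit of Georgii–Higuchi 2000, proof of
Lemma 2.1). [cite: GeorgiiHiguchi2000, Lemma 2.1 (proof, pp. 4–5)] -/
noncomputable def explVolume (G : SimpleGraph V) (Λ : Finset V) (T : Set V) : Finset V :=
  open Classical in Λ.filter fun y => ¬ Exitable G Λ T y

/-- Membership in the exploration volume. [cite: GeorgiiHiguchi2000, Lemma 2.1 (proof, pp. 4–5)] -/
@[simp] theorem mem_explVolume_iff {Λ : Finset V} {T : Set V} {y : V} :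
    y ∈ explVolume G Λ T ↔ y ∈ Λ ∧ ¬ Exitable G Λ T y := by
  classical
  simp [explVolume]

/-- The exploration volume is part of the volume. [cite: GeorgiiHiguchi2000, Lemma 2.1 (proof, pp. 4–5)] -/
theorem explVolume_subset (Λ : Finset V) (T : Set V) : explVolume G Λ T ⊆ Λ := fun _ hy =>
  (mem_explVolume_iff.1 hy).1

/-- The exploration volume shrinks when more sites are passable. [cite: GeorgiiHiguchi2000, Lemma 2.1 (proof, pp. 4–5)] -/
theorem explVolume_anti {Λ : Finset V} {T T' : Set V} (h : T ⊆ T') :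
    explVolume G Λ T' ⊆ explVolume G Λ T := fun y hy => by
  rw [mem_explVolume_iff] at hy ⊢
  exact ⟨hy.1, fun hex => hy.2 (hex.of_subset h)⟩

/-- **Boundary property**: a site outside the exploration volume and adjacent to it lies in `Λ`
and is not passable (Georgii–Higuchi 2000, proof of Lemma 2.1: the outermost `-∗`circuit carries
`-` spins; here: the outer vertex boundary of the exploration volume for `T = {+ spins}` is `-`). [cite: GeorgiiHiguchi2000, Lemma 2.1 (proof, pp. 4–5)] -/
theorem not_mem_of_adj_explVolume {Λ : Finset V} {T : Set V} {y z : V}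
    (hy : y ∈ explVolume G Λ T) (hz : z ∉ explVolume G Λ T) (hadj : G.Adj y z) :
    z ∈ Λ ∧ z ∉ T := by
  rw [mem_explVolume_iff] at hy
  have hzΛ : z ∈ Λ := by
    by_contra hzΛ
    exact hy.2 (.base hy.1 hzΛ hadj)
  refine ⟨hzΛ, fun hzT => hy.2 (.step hy.1 hzT hadj ?_)⟩
  by_contra hzex
  exact hz (mem_explVolume_iff.2 ⟨hzΛ, hzex⟩)

/-- **Determination from outside**: `explVolume G Λ T = Γ` holds iff it holds for the passable
set `T ∩ (Λ \ Γ)` — the event "the exploration volume is `Γ`" only looks at the passability of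
sites of `Λ` outside `Γ` (Georgii–Higuchi 2000, proof of Lemma 2.1: "by maximality, `Γ` is
determined from outside"). [cite: GeorgiiHiguchi2000, Lemma 2.1 (proof, pp. 4–5)] -/
theorem explVolume_eq_iff {Λ Γ : Finset V} {T : Set V} :
    explVolume G Λ T = Γ ↔ explVolume G Λ (T ∩ (↑Λ \ ↑Γ)) = Γ := by
  -- `explVolume … = Γ` means `{exitable} = Λ \ Γ` and `Γ ⊆ Λ`
  have key : ∀ T' : Set V, explVolume G Λ T' = Γ ↔
      Γ ⊆ Λ ∧ {v | Exitable G Λ T' v} = (↑Λ \ ↑Γ : Set V) := by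
    intro T'
    constructor
    · intro h
      refine ⟨h ▸ explVolume_subset Λ T', Set.ext fun v => ?_⟩
      simp only [Set.mem_setOf_eq, Set.mem_sdiff, Finset.mem_coe, ← h, mem_explVolume_iff,
        not_and, not_not]
      exact ⟨fun hv => ⟨hv.mem, fun _ => hv⟩, fun hv => hv.2 hv.1⟩
    · rintro ⟨hΓ, h⟩
      ext v
      have hv := Set.ext_iff.1 h v
      simp only [Set.mem_setOf_eq, Set.mem_sdiff, Finset.mem_coe] at hv
      rw [mem_explVolume_iff, hv]
      constructor
      · rintro ⟨hvΛ, hnot⟩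
        by_contra hvΓ
        exact hnot ⟨hvΛ, hvΓ⟩
      · intro hvΓ
        exact ⟨hΓ hvΓ, fun h' => h'.2 hvΓ⟩
  rw [key, key, setOf_exitable_eq_iff (T := T) (E := (↑Λ \ ↑Γ : Set V))]

/-- If a site `y` of `Λ` with no neighbour outside `Λ` fails to be in the exploration volume, then
some passable neighbour `t ∈ T ∩ Λ` of `y` is joined through passable sites of `Λ` to a passable
site of the inner vertex boundary of `Λ` (Georgii–Higuchi 2000, proof of Lemma 2.1: if the
square `Δ` is not enclosed, a `+`path runs from next to `Δ` to the boundary of `Λ`). [cite: GeorgiiHiguchi2000, Lemma 2.1 (proof, pp. 4–5)] -/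
theorem exists_reachable_innerBoundary_of_not_mem_explVolume [DecidableEq V] [G.LocallyFinite]
    {Λ : Finset V} {T : Set V} {y : V} (hyΛ : y ∈ Λ) (hy : y ∉ explVolume G Λ T)
    (hfar : ∀ z, G.Adj y z → z ∈ Λ) :
    ∃ t t', t ∈ T ∧ t ∈ Λ ∧ G.Adj y t ∧ t' ∈ T ∧ t' ∈ innerBoundary G Λ ∧
      (Percolation.siteOpenGraph G (T ∩ ↑Λ)).Reachable t t' := by
  have hex : Exitable G Λ T y := by
    by_contra h
    exact hy (mem_explVolume_iff.2 ⟨hyΛ, h⟩)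
  cases hex with
  | base _ hz hadj => exact absurd (hfar _ hadj) hz
  | @step _ t _ ht hadj hext =>
    obtain ⟨t', ht'Λ, ht'T, ⟨z, hz, hzadj⟩, hreach⟩ := hext.exists_reachable ht
    refine ⟨t, t', ht, hext.mem, hadj, ht'T, ?_, hreach⟩
    rw [mem_innerBoundary_iff]
    exact ⟨ht'Λ, z, hz, hzadj⟩

end Literature.Probability.LatticeModels
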